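import Summits.HodgeConjecture.HodgeConjecture.Theorems.F0P6aStubKOTTRows   -- ★ previous part of the same Lines workfile `F0_P6a_StubKOTT` (size-lint split ×2)
import HarnessLib

/-!
# `F0P6aStubKOTT` — ★ RE-HOME of `Lines/F0_P6a_StubKOTT.lean`, PART 2 of 2 (size-lint split; cut at a declaration boundary).

See PART 1 `Theorems/F0P6aStubKOTTRows.lean` for the full re-home header and the original module docstring (verbatim there). Namespaces and sections KEPT
(re-opened below exactly as they stand at the cut, with their `open`∕`variable` lines replayed); code bytes = the workfile՚s, docstrings included; options preamble repeated from PART 1.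
HC_CM is proved only modulo the 7 printed citations (2 remaining: hLiu418 = stmt-HodgeConjecture-24832, h413 = stmt-HodgeConjecture-24833) until rung 0 closes; a re-home is count-neutral. -/

set_option autoImplicit false

noncomputable section

namespace Summit.HodgeConjecture.HodgeConjecture.Cruxes.HLiu418.F0P6aStubKOTT
set_option linter.dupNamespace false  -- `Summit.HodgeConjecture.HodgeConjecture.…` BY DESIGN (D-0017)
open CategoryTheory CategoryTheory.Limits NumberField IsDedekindDomain MulAction AlgebraicGeometry
open scoped Matrix Polynomial Pointwise
open Literature.NumberTheory.GaloisRepresentations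
open Literature.NumberTheory.Automorphic Literature.NumberTheory.Automorphic.UnitaryGroup
open Literature.AlgebraicGeometry.ShimuraVarieties.UnitaryCanonicalModel
open Literature.NumberTheory.Automorphic.Liu2021.AppendixC
open Literature.AlgebraicGeometry.Motives (AlgPoints ComplexPoints IntegralModel SchemeOver thickening thickeningGalAction thickeningLift
  thickeningπ baseChange specOver)
open Literature.AlgebraicGeometry.Motives.AbelianVariety (cotangentMap bcSpec)
open Literature.AlgebraicGeometry.AbelianSchemes (AbelianSchemeOver)
open Literature.AlgebraicGeometry.AbelianSchemes.AbelianSchemeOver (fibreHom RingAction kottwitz_iff_of_tupleIsoVia)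
open Literature.NumberTheory.DiophantineGeometry (geomResidueField specialFibreFunctor)
open Literature.AlgebraicGeometry.RelativeSpec (ActionOver)
open Literature.NumberTheory.EllipticCurves (genericFibre)
open Summit.HodgeConjecture.HodgeConjecture.Cruxes.HLiu418.F0P6aModuliDatumDefs
open Summit.HodgeConjecture.HodgeConjecture.Cruxes.HLiu418.F0P6aRGDAssembly
open Summit.HodgeConjecture.HodgeConjecture.Cruxes.HLiu418.F0P6aPELWitnessE (PELWitnessE IsCMTypeThrough mOf)
open Summit.HodgeConjecture.HodgeConjecture.Cruxes.HLiu418.F0P6aIsomSchemeFiniteType (TupleIsoAt₂)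
open Summit.HodgeConjecture.HodgeConjecture.Theorems.F0P6aKottwitzAtOmegaOfComplexPoints
open Summit.HodgeConjecture.HodgeConjecture.Theorems.F0P6aKottwitzCountAtSplitPlace (exists_restrict sum_filter_ker_residue_restrict_eq_one
  exists_cmType_adapted)


/-! ### The CONSTRUCTOR side of (K-prov-2): GEN՚s O1 choice `Φ(w)` — the adapted frame of ★ p847313 pushed forward along a complex embedding of `F̄_w`
over `ι₁` — satisfies `KottAdaptedAt ι₁ w Φ(w)` and `IsCMTypeThrough ι₁ Φ(w)` (so `stub_SPREAD`՚s constructor pays the new provenance field by `exact`) -/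

section Constructor

variable {F : Type} [Field F] [NumberField F] [IsCMField F]

omit [IsCMField F] in
/-- Every complex embedding of the Galois field `F` is `σ₀ ∘ τ` for an embedding `τ : F →+* F̄_w` (normality: `φ = ι₁ ∘ g`, `g ∈ Gal(F∕ℚ)`, Mathlib
`AlgHom.restrictNormal`; then `τ := τ_w ∘ g`). [cite: RapoportSmithlingZhang2020Diagonal, Remark 3.6 (i) (3.14) p. 13] -/
theorem exists_eq_comp_of_isGalois [IsGalois ℚ F] (ι₁ : F →+* ℂ) (w : HeightOneSpectrum (𝓞 F))
    (σ₀ : AlgebraicClosure (w.adicCompletion F) →+* ℂ)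
    (hσ₀ : σ₀.comp ((algebraMap (w.adicCompletion F) (AlgebraicClosure (w.adicCompletion F))).comp (algebraMap F (w.adicCompletion F))) = ι₁)
    (φ : F →+* ℂ) :
    ∃ τ : F →+* AlgebraicClosure (w.adicCompletion F), φ = σ₀.comp τ := by
  letI : Algebra F ℂ := ι₁.toAlgebra
  let g : F →ₐ[ℚ] F := (φ.toRatAlgHom).restrictNormal F
  have hg : ∀ x, ι₁ (g x) = φ x := fun x => AlgHom.restrictNormal_commutes φ.toRatAlgHom F x
  refine ⟨((algebraMap (w.adicCompletion F) (AlgebraicClosure (w.adicCompletion F))).comp (algebraMap F (w.adicCompletion F))).comp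
    (g : F →+* F), RingHom.ext fun x => ?_⟩
  rw [← RingHom.comp_assoc, hσ₀, RingHom.comp_apply, ← hg]
  rfl

omit [IsCMField F] in
/-- `σ₀ ∘ ·` is injective on embeddings `F →+* F̄_w`. [cite: RapoportSmithlingZhang2020Diagonal, §3.1 p. 8; §4.1 (4.7)–(4.8) p. 16] -/
theorem comp_injective_of_ringHom (w : HeightOneSpectrum (𝓞 F)) (σ₀ : AlgebraicClosure (w.adicCompletion F) →+* ℂ) :
    Function.Injective (fun τ : F →+* AlgebraicClosure (w.adicCompletion F) => σ₀.comp τ) :=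
  fun _ _ h => RingHom.ext fun x => σ₀.injective (RingHom.congr_fun h x)

/-- Complex conjugation of the partner is the partner of the conjugate: `conjugate (σ₀ ∘ τ) = σ₀ ∘ (τ ∘ c)` (Mathlib `IsCMField.complexEmbedding_complexConj`
for the complex embedding `σ₀ ∘ τ` of the CM field `F`). [cite: RapoportSmithlingZhang2020Diagonal, §3.1 p. 8; §4.1 (4.7)–(4.8) p. 16] -/
theorem conjugate_comp_eq (w : HeightOneSpectrum (𝓞 F)) (σ₀ : AlgebraicClosure (w.adicCompletion F) →+* ℂ)
    (τ : F →+* AlgebraicClosure (w.adicCompletion F)) :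
    ComplexEmbedding.conjugate (σ₀.comp τ) = σ₀.comp (τ.comp ((IsCMField.complexConj F : F ≃ₐ[↥(maximalRealSubfield F)] F) : F →+* F)) := by
  ext x
  rw [ComplexEmbedding.conjugate_coe_eq]
  change _ = (σ₀.comp τ) (IsCMField.complexConj F x)
  rw [IsCMField.complexEmbedding_complexConj]

/-- **THE PUSHED-FORWARD FRAME IS `w`-ADAPTED**: for the (unique) restriction family `τR₀` and a finite set `Φw` of `p`-adic embeddings containing the `c•w`-block
off `τ_w ∘ c` (★ p847313 `exists_cmType_adapted`, third conjunct), the complex frame `Φ := {σ₀ ∘ τ ∣ τ ∈ Φw}` satisfies `KottAdaptedAt ι₁ w Φ` — uniqueness of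
restriction families (`Subtype.ext`) and canonicity of `σ ∘ τ` for `F` Galois (★ p847344 `comp_eq_comp_of_isGalois`).
[cite: RapoportSmithlingZhang2020Diagonal, §4.1 (4.6) p. 16 and p. 17; §3.1 p. 8; §4.1 (4.7)–(4.8) p. 16] -/
theorem kottAdaptedAt_image_of_block_subset [IsGalois ℚ F] (ι₁ : F →+* ℂ) (w : HeightOneSpectrum (𝓞 F))
    (σ₀ : AlgebraicClosure (w.adicCompletion F) →+* ℂ)
    (hσ₀ : σ₀.comp ((algebraMap (w.adicCompletion F) (AlgebraicClosure (w.adicCompletion F))).comp (algebraMap F (w.adicCompletion F))) = ι₁)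
    (τR₀ : (F →+* AlgebraicClosure (w.adicCompletion F)) → (𝓞 F →+* ↥(closureValuationSubring (w.adicCompletion F))))
    (hτR₀ : ∀ (τ : F →+* AlgebraicClosure (w.adicCompletion F)) (x : 𝓞 F),
      ((τR₀ τ x : ↥(closureValuationSubring (w.adicCompletion F))) : AlgebraicClosure (w.adicCompletion F)) = τ (x : F))
    (Φw : Finset (F →+* AlgebraicClosure (w.adicCompletion F)))
    (hblock : ∀ τ : F →+* AlgebraicClosure (w.adicCompletion F),
      RingHom.ker ((IsLocalRing.residue ↥(closureValuationSubring (w.adicCompletion F))).comp (τR₀ τ)) =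
        ((IsCMField.complexConj F) • w).asIdeal →
      τ ≠ ((algebraMap (w.adicCompletion F) (AlgebraicClosure (w.adicCompletion F))).comp (algebraMap F (w.adicCompletion F))).comp
        ((IsCMField.complexConj F : F ≃ₐ[↥(maximalRealSubfield F)] F) : F →+* F) → τ ∈ Φw) :
    KottAdaptedAt ι₁ w {φ | ∃ τ ∈ Φw, φ = σ₀.comp τ} := by
  intro τR hτR σ hσ τ hτ hne
  -- the restriction family is unique
  have hRR : τR = τR₀ := funext fun τ' => RingHom.ext fun x => Subtype.ext ((hτR τ' x).trans (hτR₀ τ' x).symm)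
  subst hRR
  exact ⟨τ, hblock τ hτ hne, comp_eq_comp_of_isGalois F _ σ σ₀ (hσ.trans hσ₀.symm) τ⟩

/-- **THE PUSHED-FORWARD FRAME IS A CM TYPE THROUGH `ι₁`**: if `Φw ∋ τ_w` is a CM type of `p`-adic embeddings (`τ ∈ Φw ↔ τ ∘ c ∉ Φw`; ★ p847313
`exists_cmType_adapted`, first two conjuncts) then `Φ := {σ₀ ∘ τ ∣ τ ∈ Φw}` satisfies `IsCMTypeThrough ι₁ Φ` (every complex embedding of the Galois field `F`
is some `σ₀ ∘ τ`; `σ₀ ∘ ·` is injective; `conjugate (σ₀ ∘ τ) = σ₀ ∘ (τ ∘ c)`). [cite: RapoportSmithlingZhang2020Diagonal, §3.1 p. 8; §4.1 (4.7)–(4.8) p. 16; Remark 3.6 (i) (3.14) p. 13] -/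
theorem isCMTypeThrough_image_of_cmType [IsGalois ℚ F] (ι₁ : F →+* ℂ) (w : HeightOneSpectrum (𝓞 F))
    (σ₀ : AlgebraicClosure (w.adicCompletion F) →+* ℂ)
    (hσ₀ : σ₀.comp ((algebraMap (w.adicCompletion F) (AlgebraicClosure (w.adicCompletion F))).comp (algebraMap F (w.adicCompletion F))) = ι₁)
    (Φw : Finset (F →+* AlgebraicClosure (w.adicCompletion F)))
    (h₀ : (algebraMap (w.adicCompletion F) (AlgebraicClosure (w.adicCompletion F))).comp (algebraMap F (w.adicCompletion F)) ∈ Φw)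
    (hcm : ∀ τ : F →+* AlgebraicClosure (w.adicCompletion F),
      τ ∈ Φw ↔ τ.comp ((IsCMField.complexConj F : F ≃ₐ[↥(maximalRealSubfield F)] F) : F →+* F) ∉ Φw) :
    IsCMTypeThrough ι₁ {φ | ∃ τ ∈ Φw, φ = σ₀.comp τ} := by
  have hinj := comp_injective_of_ringHom w σ₀
  have hmem : ∀ τ : F →+* AlgebraicClosure (w.adicCompletion F),
      σ₀.comp τ ∈ {φ : F →+* ℂ | ∃ τ ∈ Φw, φ = σ₀.comp τ} ↔ τ ∈ Φw := by
    intro τ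
    refine ⟨fun ⟨τ', hτ', h⟩ => ?_, fun h => ⟨τ, h, rfl⟩⟩
    rwa [hinj h]
  refine ⟨⟨_, h₀, hσ₀.symm⟩, fun φ => ?_⟩
  obtain ⟨τ, rfl⟩ := exists_eq_comp_of_isGalois ι₁ w σ₀ hσ₀ φ
  rw [hmem, conjugate_comp_eq w σ₀ τ, hmem]
  exact hcm τ

/-- **GEN՚s O1 CHOICE EXISTS: an ADAPTED FRAME CM TYPE THROUGH `ι₁` at every split place** — ★ p847313 `exists_restrict` + `exists_cmType_adapted` pushed forward
along any complex embedding `σ₀` of `F̄_w` over `ι₁` (★ p847344 `exists_ringHom_comp_eq`): `∃ Φ, IsCMTypeThrough ι₁ Φ ∧ KottAdaptedAt ι₁ w Φ`.  With it the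
`stub_SPREAD` constructor pays the provenance fields `hΦ`, `hΦw` of `PELSpreadAt` (cure (K-a) of «M-50») by `obtain ⟨Φ, hΦ, hΦw⟩ := exists_adapted_frame ι₁ w hw`.
[cite: RapoportSmithlingZhang2020Diagonal, §4.1 (4.6) p. 16 and p. 17; §3.1 p. 8; §4.1 (4.7)–(4.8) p. 16] [cite: Kottwitz1992, §5 p. 390] -/
theorem exists_adapted_frame [IsGalois ℚ F] (ι₁ : F →+* ℂ) (w : HeightOneSpectrum (𝓞 F)) (hw : (IsCMField.complexConj F) • w ≠ w) :
    ∃ Φ : Set (F →+* ℂ), IsCMTypeThrough ι₁ Φ ∧ KottAdaptedAt ι₁ w Φ := by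
  obtain ⟨σ₀, hσ₀⟩ := exists_ringHom_comp_eq F w F
    ((algebraMap (w.adicCompletion F) (AlgebraicClosure (w.adicCompletion F))).comp (algebraMap F (w.adicCompletion F))) ι₁
  obtain ⟨τR₀, hτR₀⟩ := exists_restrict w
  obtain ⟨Φw, h₀, hcm, hblock⟩ := exists_cmType_adapted w τR₀ hτR₀ hw
  exact ⟨_, isCMTypeThrough_image_of_cmType ι₁ w σ₀ hσ₀ Φw h₀ hcm,
    kottAdaptedAt_image_of_block_subset ι₁ w σ₀ hσ₀ τR₀ hτR₀ Φw hblock⟩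

end Constructor

/-! ### ED. 2 (LEAD F0P6-plan (g3) «M-57b» (1)(b) ∕ «M-57c», 2026-09-02; pen LA6-p03 (g0); countersign rule of the leaf author A-p14 (g35), dossier §KOTT): THE UNMIXED FRAME.
ADD-ONLY over ED. 1 (5ae7ceedafae9d09): every ED. 1 statement and proof is byte-identical (DOCSTRING-ONLY fold of the six ED. 1 RSZ page-10 cite locators to «§3.1 p. 8;
§4.1 (4.7)–(4.8) p. 16», F0P6-lit1 (g5) P6L-124, LEAD «M-60» (b)).  NEW: the provenance text `UnmixedAt ι₁ w Φ` (K-prov-3) in the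
complex-embedding currency of `KottAdaptedAt`; the three `mOf`-FEEDS of the spine ED. 4 signature rows for `m τ := mOf ι₁ Φ (σ ∘ τ)` — row 35 `m_pair` from
`IsCMTypeThrough` (`mOf_comp_add_mOf_comp_comp_complexConj`), row 36 `m_banal` from the blocks (`mOf_comp_eq_zero_or_two_of_banal`), row 39 `m_unmixed` from
`UnmixedAt` (`mOf_comp_eq_of_unmixedAt`); and the constructor `exists_adapted_unmixed_frame` (= `exists_adapted_frame` + ★ p847916 `exists_cmType_adapted_unmixed`
pushed forward along `σ₀`).  «Q-MIX is dissolved, not paid»: with an unmixed frame every banal block of the Kottwitz signature is CONSTANT (`∈ {0, 2}`). -/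

section Unmixed

variable {F : Type} [Field F] [NumberField F] [IsCMField F]

open Summit.HodgeConjecture.HodgeConjecture.Theorems.F0P6aKottwitzCountAtSplitPlace (ker_residue_restrict_structural
  ker_residue_restrict_structural_comp_complexConj)
open Summit.HodgeConjecture.HodgeConjecture.Theorems.F0P6aKottwitzUnmixedFrame (exists_cmType_adapted_unmixed comp_mem_image_iff_of_unmixed
  comp_left_injective)

/-- **PROVENANCE TEXT (K-prov-3) `UnmixedAt ι₁ w Φ` — «the frame `Φ` is UNMIXED at the banal places over `p`»**, in the tokens of `KottAdaptedAt` (same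
binders `τR`, `hτR`, `σ` over `ι₁`; conclusion an `↔`): for every restriction family `τR` (unique), every `σ : F̄_w →+* ℂ` over `ι₁` and every two embeddings
`τ τ' : F →+* F̄_w` inducing the SAME prime `ker (residue ∘ τR τ) = ker (residue ∘ τR τ')` other than `𝔭_w` and `𝔭_{c•w}`, the complex partners `σ ∘ τ`, `σ ∘ τ'`
lie in `Φ` together — so the Kottwitz signature `mOf ι₁ Φ (σ ∘ ·)` is constant on every banal block (`mOf_comp_eq_of_unmixedAt`), every banal block of the
`𝔭`-torsion is étale (`m ≡ 0`) or multiplicative (`m ≡ 2`), and no mixed block occurs (LEAD «M-57b» (1)).  Spine ED. 4 row `m_unmixed`; P-line v6g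
provenance `hΦu`. [cite: RapoportSmithlingZhang2020Diagonal, §4.1 (4.6)–(4.8) p. 16 (banal signature type); App. B p. 58; §4.1 (4.6) p. 16 and p. 17] [cite: Kottwitz1992, §5 p. 390] -/
def UnmixedAt {F : Type} [Field F] [NumberField F] [IsCMField F] (ι₁ : F →+* ℂ) (w : HeightOneSpectrum (𝓞 F))
    (Φ : Set (F →+* ℂ)) : Prop :=
  ∀ (τR : (F →+* AlgebraicClosure (w.adicCompletion F)) → (𝓞 F →+* ↥(closureValuationSubring (w.adicCompletion F)))),
    (∀ (τ : F →+* AlgebraicClosure (w.adicCompletion F)) (x : 𝓞 F),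
      ((τR τ x : ↥(closureValuationSubring (w.adicCompletion F))) : AlgebraicClosure (w.adicCompletion F)) = τ (x : F)) →
    ∀ (σ : AlgebraicClosure (w.adicCompletion F) →+* ℂ),
      σ.comp ((algebraMap (w.adicCompletion F) (AlgebraicClosure (w.adicCompletion F))).comp (algebraMap F (w.adicCompletion F))) = ι₁ →
      ∀ τ τ' : F →+* AlgebraicClosure (w.adicCompletion F),
        RingHom.ker ((IsLocalRing.residue ↥(closureValuationSubring (w.adicCompletion F))).comp (τR τ)) =
          RingHom.ker ((IsLocalRing.residue ↥(closureValuationSubring (w.adicCompletion F))).comp (τR τ')) →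
        RingHom.ker ((IsLocalRing.residue ↥(closureValuationSubring (w.adicCompletion F))).comp (τR τ)) ≠ w.asIdeal →
        RingHom.ker ((IsLocalRing.residue ↥(closureValuationSubring (w.adicCompletion F))).comp (τR τ)) ≠
          ((IsCMField.complexConj F) • w).asIdeal →
        (σ.comp τ ∈ Φ ↔ σ.comp τ' ∈ Φ)

section Feeds

variable (ι₁ : F →+* ℂ) (w : HeightOneSpectrum (𝓞 F)) (Φ : Set (F →+* ℂ))
  (τR : (F →+* AlgebraicClosure (w.adicCompletion F)) → (𝓞 F →+* ↥(closureValuationSubring (w.adicCompletion F))))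
  (hτR : ∀ (τ : F →+* AlgebraicClosure (w.adicCompletion F)) (x : 𝓞 F),
    ((τR τ x : ↥(closureValuationSubring (w.adicCompletion F))) : AlgebraicClosure (w.adicCompletion F)) = τ (x : F))
  (σ : AlgebraicClosure (w.adicCompletion F) →+* ℂ)
  (hσ : σ.comp ((algebraMap (w.adicCompletion F) (AlgebraicClosure (w.adicCompletion F))).comp (algebraMap F (w.adicCompletion F))) = ι₁)

include hτR hσ in
/-- **A BANAL EMBEDDING HAS ITS COMPLEX PARTNER OFF THE PAIR `{ι₁, ῑ₁}`**: if `τ` induces neither `𝔭_w` nor `𝔭_{c•w}` then `σ ∘ τ ≠ ι₁ = σ ∘ τ_w` (★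
`ker_residue_restrict_structural`: `τ_w` induces `𝔭_w`) and `σ ∘ τ ≠ ῑ₁ = σ ∘ (τ_w ∘ c)` (`conjugate_comp_eq`, ★ `ker_residue_restrict_structural_comp_complexConj`), by
injectivity of `σ ∘ ·`. [cite: RapoportSmithlingZhang2020Diagonal, §4.1 (4.6)–(4.8) p. 16 (banal signature type); App. B p. 58; Remark 3.6 (i) (3.14) p. 13] -/
theorem comp_ne_and_comp_ne_conjugate_of_banal (τ : F →+* AlgebraicClosure (w.adicCompletion F))
    (hw₁ : RingHom.ker ((IsLocalRing.residue ↥(closureValuationSubring (w.adicCompletion F))).comp (τR τ)) ≠ w.asIdeal)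
    (hw₂ : RingHom.ker ((IsLocalRing.residue ↥(closureValuationSubring (w.adicCompletion F))).comp (τR τ)) ≠ ((IsCMField.complexConj F) • w).asIdeal) :
    σ.comp τ ≠ ι₁ ∧ σ.comp τ ≠ ComplexEmbedding.conjugate ι₁ := by
  have hτwc : σ.comp (((algebraMap (w.adicCompletion F) (AlgebraicClosure (w.adicCompletion F))).comp (algebraMap F (w.adicCompletion F))).comp
      ((IsCMField.complexConj F : F ≃ₐ[↥(maximalRealSubfield F)] F) : F →+* F)) = ComplexEmbedding.conjugate ι₁ := by
    rw [← hσ, conjugate_comp_eq w σ]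
  refine ⟨fun h => hw₁ ?_, fun h => hw₂ ?_⟩
  · rw [comp_left_injective w σ (h.trans hσ.symm), ker_residue_restrict_structural w τR hτR]
  · rw [comp_left_injective w σ (h.trans hτwc.symm), ker_residue_restrict_structural_comp_complexConj w τR hτR]

include hτR hσ in
/-- **FEED of the spine ED. 4 row `m_banal` (row 36)**: the Kottwitz signature `m τ := mOf ι₁ Φ (σ ∘ τ)` of ANY frame `Φ` takes a BANAL VALUE `0` or `2` at every
embedding inducing neither `𝔭_w` nor `𝔭_{c•w}` — BY DEFINITION of `mOf` (`1` only on the pair `{ι₁, ῑ₁}`, whose blocks are `𝔭_w`, `𝔭_{c•w}`).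
[cite: RapoportSmithlingZhang2020Diagonal, §3.2 (3.8) p. 11; Remark 3.6 (i) (3.14) p. 13] [cite: Kottwitz1992, §5 p. 390] -/
theorem mOf_comp_eq_zero_or_two_of_banal (τ : F →+* AlgebraicClosure (w.adicCompletion F))
    (hw₁ : RingHom.ker ((IsLocalRing.residue ↥(closureValuationSubring (w.adicCompletion F))).comp (τR τ)) ≠ w.asIdeal)
    (hw₂ : RingHom.ker ((IsLocalRing.residue ↥(closureValuationSubring (w.adicCompletion F))).comp (τR τ)) ≠ ((IsCMField.complexConj F) • w).asIdeal) :
    mOf ι₁ Φ (σ.comp τ) = 0 ∨ mOf ι₁ Φ (σ.comp τ) = 2 := by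
  classical
  obtain ⟨h₁, h₂⟩ := comp_ne_and_comp_ne_conjugate_of_banal ι₁ w τR hτR σ hσ τ hw₁ hw₂
  by_cases hmem : σ.comp τ ∈ Φ
  · left; simp only [mOf, h₁, h₂, or_self, if_false, hmem, if_true]
  · right; simp only [mOf, h₁, h₂, or_self, if_false, hmem]

omit [NumberField F] [IsCMField F] in
/-- `mOf φ + mOf φ̄ = 2` for a CM type `Φ` through `ι₁` and EVERY complex embedding `φ`: `1 + 1` on the pair `{ι₁, ῑ₁}`, else `0 + 2` or `2 + 0` by the CM condition
`φ ∈ Φ ↔ φ̄ ∉ Φ`. [cite: RapoportSmithlingZhang2020Diagonal, §3.2 (3.8) p. 11; Remark 3.6 (i) (3.14) p. 13] -/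
theorem mOf_add_mOf_conjugate_eq_two (hΦ : IsCMTypeThrough ι₁ Φ) (φ : F →+* ℂ) :
    mOf ι₁ Φ φ + mOf ι₁ Φ (ComplexEmbedding.conjugate φ) = 2 := by
  classical
  have hinv : ComplexEmbedding.conjugate (ComplexEmbedding.conjugate φ) = φ := ComplexEmbedding.involutive_conjugate F φ
  by_cases hp : φ = ι₁ ∨ φ = ComplexEmbedding.conjugate ι₁
  · have hp' : ComplexEmbedding.conjugate φ = ι₁ ∨ ComplexEmbedding.conjugate φ = ComplexEmbedding.conjugate ι₁ := by
      rcases hp with rfl | rfl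
      · exact Or.inr rfl
      · exact Or.inl (ComplexEmbedding.involutive_conjugate F ι₁)
    simp only [mOf, hp, hp', if_true]
  · have h₁ : φ ≠ ι₁ := fun h => hp (Or.inl h)
    have h₂ : φ ≠ ComplexEmbedding.conjugate ι₁ := fun h => hp (Or.inr h)
    have h₁' : ComplexEmbedding.conjugate φ ≠ ι₁ := fun h => h₂ (by rw [← h, hinv])
    have h₂' : ComplexEmbedding.conjugate φ ≠ ComplexEmbedding.conjugate ι₁ := fun h =>
      h₁ ((ComplexEmbedding.involutive_conjugate F).injective h)
    by_cases hmem : φ ∈ Φ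
    · have hmem' : ComplexEmbedding.conjugate φ ∉ Φ := (hΦ.2 φ).mp hmem
      simp only [mOf, h₁, h₂, h₁', h₂', or_self, if_false, hmem, hmem', if_true]
    · have hmem' : ComplexEmbedding.conjugate φ ∈ Φ := by
        by_contra h
        exact hmem ((hΦ.2 φ).mpr h)
      simp only [mOf, h₁, h₂, h₁', h₂', or_self, if_false, hmem, hmem', if_true]

/-- **FEED of the spine ED. 4 row `m_pair` (row 35)**: `m τ + m (τ ∘ c) = 2` for `m τ := mOf ι₁ Φ (σ ∘ τ)` and a CM type `Φ` through `ι₁` — the complex partner of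
`τ ∘ c` is the conjugate of that of `τ` (`conjugate_comp_eq`). [cite: RapoportSmithlingZhang2020Diagonal, §3.2 (3.8) p. 11; Remark 3.6 (i) (3.14) p. 13]
[cite: Kottwitz1992, §5 p. 390] -/
theorem mOf_comp_add_mOf_comp_comp_complexConj (hΦ : IsCMTypeThrough ι₁ Φ) (τ : F →+* AlgebraicClosure (w.adicCompletion F)) :
    mOf ι₁ Φ (σ.comp τ) + mOf ι₁ Φ (σ.comp (τ.comp ((IsCMField.complexConj F : F ≃ₐ[↥(maximalRealSubfield F)] F) : F →+* F))) = 2 := by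
  rw [← conjugate_comp_eq w σ τ]
  exact mOf_add_mOf_conjugate_eq_two ι₁ Φ hΦ (σ.comp τ)

include hτR hσ in
/-- **FEED of the spine ED. 4 row `m_unmixed` (row 39)**: under (K-prov-3) `UnmixedAt ι₁ w Φ`, the Kottwitz signature `m τ := mOf ι₁ Φ (σ ∘ τ)` is CONSTANT on every
banal block — both partners are off the pair (`comp_ne_and_comp_ne_conjugate_of_banal`), so `mOf` reads `if · ∈ Φ then 0 else 2` on both, and `UnmixedAt` equates
the conditions. [cite: RapoportSmithlingZhang2020Diagonal, §4.1 (4.6)–(4.8) p. 16 (banal signature type); App. B p. 58; Remark 3.6 (i) (3.14) p. 13] [cite: Kottwitz1992, §5 p. 390] -/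
theorem mOf_comp_eq_of_unmixedAt (hΦu : UnmixedAt ι₁ w Φ) (τ τ' : F →+* AlgebraicClosure (w.adicCompletion F))
    (hker : RingHom.ker ((IsLocalRing.residue ↥(closureValuationSubring (w.adicCompletion F))).comp (τR τ)) =
      RingHom.ker ((IsLocalRing.residue ↥(closureValuationSubring (w.adicCompletion F))).comp (τR τ')))
    (hw₁ : RingHom.ker ((IsLocalRing.residue ↥(closureValuationSubring (w.adicCompletion F))).comp (τR τ)) ≠ w.asIdeal)
    (hw₂ : RingHom.ker ((IsLocalRing.residue ↥(closureValuationSubring (w.adicCompletion F))).comp (τR τ)) ≠ ((IsCMField.complexConj F) • w).asIdeal) :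
    mOf ι₁ Φ (σ.comp τ) = mOf ι₁ Φ (σ.comp τ') := by
  classical
  have hiff := hΦu τR hτR σ hσ τ τ' hker hw₁ hw₂
  obtain ⟨h₁, h₂⟩ := comp_ne_and_comp_ne_conjugate_of_banal ι₁ w τR hτR σ hσ τ hw₁ hw₂
  obtain ⟨h₁', h₂'⟩ := comp_ne_and_comp_ne_conjugate_of_banal ι₁ w τR hτR σ hσ τ' (hker ▸ hw₁) (hker ▸ hw₂)
  by_cases hmem : σ.comp τ ∈ Φ
  · have hmem' : σ.comp τ' ∈ Φ := hiff.mp hmem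
    simp only [mOf, h₁, h₂, h₁', h₂', or_self, if_false, hmem, hmem', if_true]
  · have hmem' : σ.comp τ' ∉ Φ := fun h => hmem (hiff.mpr h)
    simp only [mOf, h₁, h₂, h₁', h₂', or_self, if_false, hmem, hmem']

end Feeds

/-- **THE PUSHED-FORWARD FRAME IS UNMIXED**: for the (unique) restriction family `τR₀` and a finite set `Φw` of `p`-adic embeddings unmixed on the banal
blocks (★ p847916 `exists_cmType_adapted_unmixed`, last conjunct), the complex frame `Φ := {σ₀ ∘ τ ∣ τ ∈ Φw}` satisfies `UnmixedAt ι₁ w Φ` — ★ p847916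
`comp_mem_image_iff_of_unmixed` (uniqueness of restriction families; canonicity of `σ ∘ τ` for `F` Galois, ★ p847344; injectivity of `σ₀ ∘ ·`).
[cite: RapoportSmithlingZhang2020Diagonal, §4.1 (4.6)–(4.8) p. 16 (banal signature type); App. B p. 58; §4.1 p. 17] -/
theorem unmixedAt_image_of_unmixed [IsGalois ℚ F] (ι₁ : F →+* ℂ) (w : HeightOneSpectrum (𝓞 F))
    (σ₀ : AlgebraicClosure (w.adicCompletion F) →+* ℂ)
    (hσ₀ : σ₀.comp ((algebraMap (w.adicCompletion F) (AlgebraicClosure (w.adicCompletion F))).comp (algebraMap F (w.adicCompletion F))) = ι₁)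
    (τR₀ : (F →+* AlgebraicClosure (w.adicCompletion F)) → (𝓞 F →+* ↥(closureValuationSubring (w.adicCompletion F))))
    (hτR₀ : ∀ (τ : F →+* AlgebraicClosure (w.adicCompletion F)) (x : 𝓞 F),
      ((τR₀ τ x : ↥(closureValuationSubring (w.adicCompletion F))) : AlgebraicClosure (w.adicCompletion F)) = τ (x : F))
    (Φw : Finset (F →+* AlgebraicClosure (w.adicCompletion F)))
    (hunmixed : ∀ τ τ' : F →+* AlgebraicClosure (w.adicCompletion F),
      RingHom.ker ((IsLocalRing.residue ↥(closureValuationSubring (w.adicCompletion F))).comp (τR₀ τ)) =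
        RingHom.ker ((IsLocalRing.residue ↥(closureValuationSubring (w.adicCompletion F))).comp (τR₀ τ')) →
      RingHom.ker ((IsLocalRing.residue ↥(closureValuationSubring (w.adicCompletion F))).comp (τR₀ τ)) ≠ w.asIdeal →
      RingHom.ker ((IsLocalRing.residue ↥(closureValuationSubring (w.adicCompletion F))).comp (τR₀ τ)) ≠
        ((IsCMField.complexConj F) • w).asIdeal →
      (τ ∈ Φw ↔ τ' ∈ Φw)) :
    UnmixedAt ι₁ w {φ | ∃ τ ∈ Φw, φ = σ₀.comp τ} :=
  fun τR hτR σ hσ τ τ' hker hw₁ hw₂ =>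
    comp_mem_image_iff_of_unmixed ι₁ w σ₀ hσ₀ τR₀ hτR₀ Φw hunmixed τR hτR σ hσ τ τ' hker hw₁ hw₂

/-- **AN ADAPTED UNMIXED FRAME CM TYPE THROUGH `ι₁` EXISTS at every split place of a Galois CM field** — ★ p847313 `exists_restrict` + ★ p847916
`exists_cmType_adapted_unmixed` pushed forward along any complex embedding `σ₀` of `F̄_w` over `ι₁` (★ p847344 `exists_ringHom_comp_eq`):
`∃ Φ, IsCMTypeThrough ι₁ Φ ∧ KottAdaptedAt ι₁ w Φ ∧ UnmixedAt ι₁ w Φ`.  With it the `stub_SPREAD` constructor pays the provenance fields `hΦ`, `hΦw`, `hΦu` of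
`PELSpreadAt` (v6g) by `obtain ⟨Φ, hΦ, hΦw, hΦu⟩ := exists_adapted_unmixed_frame ι₁ w hw`.
[cite: RapoportSmithlingZhang2020Diagonal, §4.1 (4.6) p. 16 and p. 17; §4.1 (4.6)–(4.8) p. 16 (banal signature type); App. B p. 58] [cite: Kottwitz1992, §5 p. 390] -/
theorem exists_adapted_unmixed_frame [IsGalois ℚ F] (ι₁ : F →+* ℂ) (w : HeightOneSpectrum (𝓞 F))
    (hw : (IsCMField.complexConj F) • w ≠ w) :
    ∃ Φ : Set (F →+* ℂ), IsCMTypeThrough ι₁ Φ ∧ KottAdaptedAt ι₁ w Φ ∧ UnmixedAt ι₁ w Φ := by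
  obtain ⟨σ₀, hσ₀⟩ := exists_ringHom_comp_eq F w F
    ((algebraMap (w.adicCompletion F) (AlgebraicClosure (w.adicCompletion F))).comp (algebraMap F (w.adicCompletion F))) ι₁
  obtain ⟨τR₀, hτR₀⟩ := exists_restrict w
  obtain ⟨Φw, h₀, hcm, hblock, hunmixed⟩ := exists_cmType_adapted_unmixed w τR₀ hτR₀ hw
  exact ⟨_, isCMTypeThrough_image_of_cmType ι₁ w σ₀ hσ₀ Φw h₀ hcm,
    kottAdaptedAt_image_of_block_subset ι₁ w σ₀ hσ₀ τR₀ hτR₀ Φw hblock,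
    unmixedAt_image_of_unmixed ι₁ w σ₀ hσ₀ τR₀ hτR₀ Φw hunmixed⟩

end Unmixed

end Summit.HodgeConjecture.HodgeConjecture.Cruxes.HLiu418.F0P6aStubKOTT

end
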